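import Summits.ResolutionOfSingularities.ResolutionOfSingularities.Theorems.HilbertSamuelEliminationSigmaMaxModificationsCorridor3WLadderIsoTailsArcTranslated
import Literature.AlgebraicGeometry.Resolution.BlowupAlgebraLift
import Mathlib.RingTheory.MvPowerSeries.NoZeroDivisors
import Mathlib.RingTheory.MvPowerSeries.Inverse
import Mathlib.RingTheory.LocalRing.RingHom.Basic
import Mathlib.RingTheory.Localization.AtPrime.Basic
import HarnessLib

/-!
# [OURS · L1 W4.2 · D14 «K1 FREE-RATIONAL TAILS»] FORMAL FRAME PROPAGATION along one free-rational chart step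
# (D14-BRIDGE-CUT ROUTE H, object H6 (c); crux `SigmaMaxModifications` stmt-ResolutionOfSingularities-18506 / conjunct stmt-…-19249;
# kernel `IsoQuadraticTowerTerminates p 3`, card C5 K1)

Lead prover res-L1-w42-lead-1 (gen 4), deal D14 (res-L1-w42-plan-1 RULINGS v3.14-2 (AZ): «H6 (c)(d) + glue → lead-1»); sequel of
`…Corridor3WLadderIsoTailsArcTranslated` (p521756). Helper file `--supports stmt-ResolutionOfSingularities-19249 --as helper`; kernel only, no
named fact; the definitions `substHom`, `stepHom`, `stepLift`, `stepPrime`, `stepFrame` are the CONSTRUCTIONS of this file (proof bookkeeping,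
not statements of record). OURS (cell res-hironaka, slot W4.2); NOT statements of [Hironaka2017] nor of [CossartJannsenSaito2020] /
[CossartPiltant2009]. AI-written; AI review is weaker than expert review.

## The object

A FORMAL FRAME on a local ring `(R, 𝔪)` is a LOCAL ring homomorphism `ψ : R → κ⟦t, y₁, y₂, y₃⟧` with `ψ(t) = t` for a chosen `t ∈ 𝔪`
(at stage `n₀` of an isolated point tower: the Cohen coordinates of the completed regular presentation ring, H6 (a)(b), tree
`exists_ringEquiv_mvPowerSeries_residueField` / `comp_map_bijective`). ONE FREE-RATIONAL STEP of the tower replaces `R` by the local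
ring `R′ = R[𝔪/t]_𝔔` of the affine blowup algebra `R[𝔪/t] ⊆ R[1/t]` (res-type-071's H4 model, `…Corridor3WLadderIsoTailsEmbeddedStep`
p521738: `h = t^m · h′`, `𝒪_{X_{n+1},x_{n+1}} ≅ R′/(h′)`) at a `κ`-rational point `𝔔` of the `t`-chart. This file PROPAGATES the frame:

* `stepLift c hψt : R[𝔪/t] →+* κ⟦t, y⟧` — the lift (tree `blowupAlgebra.lift`, Görtz–Wedhorn (13.19)) of the TRANSLATED composite
  `φ_c = (y ↦ t·y + c·t) ∘ ψ` (`stepHom`, `substHom`; `φ_c(t) = t` is a non-zero-divisor and `φ_c(𝔪) ⊆ (t)` because `ψ` is local and the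
  substitution sends `𝔪_{κ⟦t,y⟧}` into `(t)`, `X_zero_dvd_subst_transChartSubst`); `stepLift_algebraMap`, `stepLift_t`;
* **`subst_transChartSubst_eq_of_strictTransform`** — if `h = t^m · h′` in `R[𝔪/t]` then `(ψ h)(t, t y + c t) = t^m · ψ′₀(h′)`: EXACTLY the
  step hypothesis `hstep` of `Series.mem_pow_of_translatedStrictTransforms` (p521756) with `g_n := ψ_n(h_n)`;
* `stepPrime c hψt = ψ′₀⁻¹(𝔪)` (a prime containing `t`: the point of the chart the frame looks at), and for any localisation `R′` of
  `R[𝔪/t]` at it: `stepFrame c hψt R′ : R′ →+* κ⟦t, y⟧`, `stepFrame_algebraMap_algebraMap` (**THE COMMUTATION** `ψ′ ∘ (R → R′) = φ_c`),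
  `stepFrame_t` (`ψ′(t) = t`), **`isLocalHom_stepFrame`** (`ψ′` is again LOCAL — the construction iterates), `…_of_strictTransform′`;
* the frame invariant that locates the point: if `ψ r ≡ y_i + λ t (mod 𝔪²)` then `ψ′₀(r/t) ≡ y_i + (c_i + λ) (mod t)`
  (`stepLift_div_sub_mem_span`), so the new coordinate `r′ = r/t − c̃` (`c̃` a lift of `c_i + λ`) has `ψ′₀(r′) ≡ y_i (mod t)`
  (`stepLift_newCoord_sub_mem_span`) and hence `≡ y_i + λ′ t (mod 𝔪²)` for a new slope (`exists_sub_C_mul_X_zero_mem_sq`) — the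
  invariant propagates, and the point `𝔔_c` has `κ`-coordinates `c_i + λ_i` (point matching with the tower's `x_{n+1}` and the assembly
  over all `n` are the sequel `…IsoTailsFormalFrameTower`).

References: U. Görtz, T. Wedhorn, *Algebraic Geometry I* (2nd ed. 2020), (13.19) p. 415 (universal property of `A[I/f]`) [GortzWedhorn2020];
V. Cossart, O. Piltant, J. Algebra 321 (2009) ch. 3 I.9 (formal arc) [CossartPiltant2009]; idea-1 card C5 (Sketch d9de4647629be5a3).
-/

noncomputable section

set_option linter.dupNamespace false -- mandated namespace of this single-conjunct summit
open MvPowerSeries IsLocalRing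
open Literature.AlgebraicGeometry.Resolution

namespace Summit.ResolutionOfSingularities.ResolutionOfSingularities.Cruxes.SigmaMaxModifications.IdeasL1C5

universe u

namespace FormalFrame

variable {κ : Type u} [Field κ]

/-! ### §1. The local ring `κ⟦t, y₁, y₂, y₃⟧` -/

/-- Membership in the maximal ideal of `κ⟦t, y⟧` is vanishing of the constant coefficient. [folklore] -/
theorem mem_maximalIdeal_iff (f : (MvPowerSeries (Fin 4) κ)) : f ∈ maximalIdeal (MvPowerSeries (Fin 4) κ) ↔ constantCoeff f = 0 := by
  rw [IsLocalRing.mem_maximalIdeal, mem_nonunits_iff, MvPowerSeries.isUnit_iff_constantCoeff, isUnit_iff_ne_zero,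
    not_not]

/-- The translated chart substitution maps the maximal ideal into `(t)`: every variable goes to a multiple of `t`. [folklore] -/
theorem X_zero_dvd_subst_transChartSubst (c : Fin 4 → κ) {f : (MvPowerSeries (Fin 4) κ)} (hf : f ∈ maximalIdeal (MvPowerSeries (Fin 4) κ)) :
    (X 0 : (MvPowerSeries (Fin 4) κ)) ∣ subst (Series.transChartSubst c) f := by
  rw [mem_maximalIdeal_iff] at hf
  rw [X_dvd_iff]
  intro e he
  rw [coeff_subst (Series.hasSubst_transChartSubst c)]
  apply finsum_eq_zero_of_forall_eq_zero
  intro d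
  by_cases hd : d = 0
  · subst hd
    rw [MvPowerSeries.coeff_zero_eq_constantCoeff_apply, hf, zero_smul]
  · -- `∏ (a s)^{d s}` is divisible by `t`
    obtain ⟨s, hs⟩ : ∃ s, d s ≠ 0 := by
      by_contra! h; exact hd (Finsupp.ext h)
    have hdvd : (X 0 : (MvPowerSeries (Fin 4) κ)) ∣ d.prod fun s e => Series.transChartSubst c s ^ e := by
      have h1 : (X 0 : (MvPowerSeries (Fin 4) κ)) ∣ Series.transChartSubst c s := by
        by_cases hs0 : s = 0
        · subst hs0; rw [Series.transChartSubst_apply_zero]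
        · rw [Series.transChartSubst_apply_of_ne _ hs0]
          exact ⟨X s + C (c s), by ring⟩
      have h2 : Series.transChartSubst c s ∣ Series.transChartSubst c s ^ d s := dvd_pow_self _ hs
      exact (h1.trans h2).trans (Finset.dvd_prod_of_mem _ (Finsupp.mem_support_iff.mpr hs))
    have hz : coeff e (d.prod fun s e => Series.transChartSubst c s ^ e) = 0 := (X_dvd_iff.mp hdvd) e he
    rw [hz, smul_zero]

/-- Hence it maps the maximal ideal into the ideal `(t)`. [folklore] -/
theorem subst_transChartSubst_mem_span_X_zero (c : Fin 4 → κ) {f : (MvPowerSeries (Fin 4) κ)} (hf : f ∈ maximalIdeal (MvPowerSeries (Fin 4) κ)) :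
    subst (Series.transChartSubst c) f ∈ Ideal.span {(X 0 : (MvPowerSeries (Fin 4) κ))} := by
  rw [Ideal.mem_span_singleton]
  exact X_zero_dvd_subst_transChartSubst c hf

/-- `t` is a non-zero-divisor of `κ⟦t, y⟧`. [folklore] -/
theorem X_zero_mem_nonZeroDivisors : (X 0 : (MvPowerSeries (Fin 4) κ)) ∈ nonZeroDivisors (MvPowerSeries (Fin 4) κ) :=
  MvPowerSeries.X_mem_nonzeroDivisors

/-! ### §2. One free-rational step: the lift to the affine blowup algebra -/

/-- The translated chart substitution as a ring endomorphism of `κ⟦t, y⟧`. [folklore] -/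
abbrev substHom (c : Fin 4 → κ) : MvPowerSeries (Fin 4) κ →+* MvPowerSeries (Fin 4) κ :=
  (substAlgHom (R := κ) (Series.hasSubst_transChartSubst c)).toRingHom

/-- Unfolding `substHom`. [folklore] -/
theorem substHom_apply (c : Fin 4 → κ) (f : MvPowerSeries (Fin 4) κ) :
    substHom c f = subst (Series.transChartSubst c) f := by
  simp [substHom]

/-- `t ↦ t`. [folklore] -/
theorem substHom_X_zero (c : Fin 4 → κ) : substHom c (X 0) = X 0 := by
  rw [substHom_apply, subst_X (Series.hasSubst_transChartSubst c), Series.transChartSubst_apply_zero]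

/-- `y_i ↦ t y_i + c_i t`. [folklore] -/
theorem substHom_X_of_ne (c : Fin 4 → κ) {i : Fin 4} (hi : i ≠ 0) : substHom c (X i) = X 0 * X i + C (c i) * X 0 := by
  rw [substHom_apply, subst_X (Series.hasSubst_transChartSubst c), Series.transChartSubst_apply_of_ne _ hi]

/-- Constants are fixed. [folklore] -/
theorem substHom_C (c : Fin 4 → κ) (a : κ) : substHom c (C a) = C a := by
  rw [substHom_apply, subst_C]

/-- `φ_c(𝔪) ⊆ (t)`. [folklore] -/
theorem substHom_mem_span_X_zero (c : Fin 4 → κ) {f : MvPowerSeries (Fin 4) κ}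
    (hf : f ∈ maximalIdeal (MvPowerSeries (Fin 4) κ)) : substHom c f ∈ Ideal.span {(X 0 : MvPowerSeries (Fin 4) κ)} := by
  rw [substHom_apply]; exact subst_transChartSubst_mem_span_X_zero c hf

/-- `φ_c(𝔪²) ⊆ (t²)`. [folklore] -/
theorem substHom_mem_span_X_zero_sq (c : Fin 4 → κ) {q : MvPowerSeries (Fin 4) κ}
    (hq : q ∈ maximalIdeal (MvPowerSeries (Fin 4) κ) ^ 2) :
    substHom c q ∈ Ideal.span {(X 0 : MvPowerSeries (Fin 4) κ) ^ 2} := by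
  have hmap : (maximalIdeal (MvPowerSeries (Fin 4) κ) ^ 2).map (substHom c) ≤ Ideal.span {(X 0) ^ 2} := by
    rw [Ideal.map_pow, ← Ideal.span_singleton_pow]
    apply Ideal.pow_right_mono
    rw [Ideal.map_le_iff_le_comap]
    intro f hf
    exact substHom_mem_span_X_zero c hf
  exact hmap (Ideal.mem_map_of_mem _ hq)

/-- `φ_c` fixes constants modulo `(t)`: `ψ x ≡ a (mod 𝔪) ⇒ φ_c(x) ≡ a (mod t)`. [folklore] -/
theorem substHom_sub_C_mem_span (c : Fin 4 → κ) {f : MvPowerSeries (Fin 4) κ} {a : κ}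
    (hf : f - C a ∈ maximalIdeal (MvPowerSeries (Fin 4) κ)) :
    substHom c f - C a ∈ Ideal.span {(X 0 : MvPowerSeries (Fin 4) κ)} := by
  have h := substHom_mem_span_X_zero c hf
  rwa [map_sub, substHom_C] at h

/-- Cancelling one `t`: `z · t ∈ (t²) ⇒ z ∈ (t)`. [folklore] -/
theorem mem_span_X_zero_of_mul_mem_sq {z : MvPowerSeries (Fin 4) κ}
    (hz : z * X 0 ∈ Ideal.span {(X 0 : MvPowerSeries (Fin 4) κ) ^ 2}) : z ∈ Ideal.span {(X 0 : MvPowerSeries (Fin 4) κ)} := by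
  rw [Ideal.mem_span_singleton] at hz ⊢
  obtain ⟨w, hw⟩ := hz
  refine ⟨w, ?_⟩
  have h : z * X 0 = (X 0 * w) * X 0 := by rw [hw]; ring
  exact mul_right_cancel₀ (nonZeroDivisors.ne_zero X_zero_mem_nonZeroDivisors) h

/-- From `(mod t)` to the frame invariant `(mod 𝔪²)` with a slope: `z ∈ (t) ⇒ ∃ λ′, z − λ′ t ∈ 𝔪²`. [folklore] -/
theorem exists_sub_C_mul_X_zero_mem_sq {z : MvPowerSeries (Fin 4) κ} (hz : z ∈ Ideal.span {(X 0 : MvPowerSeries (Fin 4) κ)}) :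
    ∃ lam' : κ, z - C lam' * X 0 ∈ maximalIdeal (MvPowerSeries (Fin 4) κ) ^ 2 := by
  rw [Ideal.mem_span_singleton] at hz
  obtain ⟨u, rfl⟩ := hz
  refine ⟨constantCoeff u, ?_⟩
  have hu : u - C (constantCoeff u) ∈ maximalIdeal (MvPowerSeries (Fin 4) κ) := by
    rw [mem_maximalIdeal_iff, map_sub, constantCoeff_C, sub_self]
  have hX : (X 0 : MvPowerSeries (Fin 4) κ) ∈ maximalIdeal (MvPowerSeries (Fin 4) κ) := by
    rw [mem_maximalIdeal_iff, constantCoeff_X]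
  have : X 0 * u - C (constantCoeff u) * X 0 = X 0 * (u - C (constantCoeff u)) := by ring
  rw [this, pow_two]
  exact Ideal.mul_mem_mul hX hu

section Step

variable {R : Type u} [CommRing R] [IsLocalRing R] (t : R) (ψ : R →+* (MvPowerSeries (Fin 4) κ)) [IsLocalHom ψ]
  (c : Fin 4 → κ)

/-- The translated composite `φ_c = (y ↦ t·y + c·t) ∘ ψ : R → κ⟦t, y⟧`. [folklore] -/
abbrev stepHom : R →+* (MvPowerSeries (Fin 4) κ) :=
  (substHom c).comp ψ

omit [IsLocalRing R] [IsLocalHom ψ] in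
/-- Unfolding `stepHom`. [folklore] -/
theorem stepHom_apply (r : R) : stepHom ψ c r = substHom c (ψ r) := rfl

variable (hψt : ψ t = X 0)
include hψt

omit [IsLocalRing R] [IsLocalHom ψ] in
/-- `φ_c(t) = t`. [folklore] -/
theorem stepHom_t : stepHom ψ c t = X 0 := by
  rw [stepHom_apply, hψt, substHom_X_zero]

omit [IsLocalRing R] [IsLocalHom ψ] in
/-- `φ_c(t)` is a non-zero-divisor. [folklore] -/
theorem stepHom_t_mem_nonZeroDivisors : stepHom ψ c t ∈ nonZeroDivisors (MvPowerSeries (Fin 4) κ) := by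
  rw [stepHom_t t ψ c hψt]; exact X_zero_mem_nonZeroDivisors

omit hψt in
/-- `φ_c(𝔪_R) ⊆ (t)`: `ψ` is local and the substitution sends `𝔪` into `(t)`. [folklore] -/
theorem map_maximalIdeal_stepHom_le :
    (maximalIdeal R).map (stepHom ψ c) ≤ Ideal.span {(X 0 : (MvPowerSeries (Fin 4) κ))} := by
  rw [Ideal.map_le_iff_le_comap]
  intro r hr
  rw [Ideal.mem_comap, stepHom_apply]
  exact substHom_mem_span_X_zero c (map_nonunit ψ r hr)

/-- **THE LIFT `ψ′₀ : R[𝔪/t] → κ⟦t, y⟧`** of `φ_c` to the affine blowup algebra (tree `blowupAlgebra.lift`, GW (13.19)). [folklore] -/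
def stepLift : blowupAlgebra (maximalIdeal R) t →+* (MvPowerSeries (Fin 4) κ) :=
  blowupAlgebra.lift (maximalIdeal R) (a := t) (φ := stepHom ψ c) (stepHom_t_mem_nonZeroDivisors t ψ c hψt)
    (by rw [stepHom_t t ψ c hψt]; exact map_maximalIdeal_stepHom_le ψ c)

variable {t ψ}

/-- The lift extends `φ_c`: on `R` it is `(y ↦ t y + c t) ∘ ψ`. [folklore] -/
theorem stepLift_algebraMap (r : R) :
    stepLift t ψ c hψt (algebraMap R _ r) = substHom c (ψ r) := by
  rw [stepLift, blowupAlgebra.lift_algebraMap, stepHom_apply]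

/-- `ψ′₀(t) = t`. [folklore] -/
theorem stepLift_t : stepLift t ψ c hψt (algebraMap R _ t) = X 0 := by
  rw [stepLift_algebraMap, hψt, substHom_X_zero]

/-- **THE STRICT-TRANSFORM EQUATION in the frame**: if `h = t^m · h′` in `R[𝔪/t]` then
`(ψ h)(t, t y + c t) = t^m · ψ′₀(h′)` — exactly the step hypothesis of `Series.mem_pow_of_translatedStrictTransforms`. [folklore] -/
theorem subst_transChartSubst_eq_of_strictTransform {h : R} {m : ℕ} {h' : blowupAlgebra (maximalIdeal R) t}
    (hh' : algebraMap R _ h = algebraMap R _ t ^ m * h') :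
    subst (Series.transChartSubst c) (ψ h) = X 0 ^ m * stepLift t ψ c hψt h' := by
  rw [← substHom_apply, ← stepLift_algebraMap c hψt, hh', map_mul, map_pow, stepLift_t]

/-- `ψ′₀(x/t) · t = φ_c(x)` for `x ∈ 𝔪_R`. [folklore] -/
theorem stepLift_div_mul {x : R} (hx : x ∈ maximalIdeal R) :
    stepLift t ψ c hψt ⟨_, div_mem_blowupAlgebra (maximalIdeal R) t hx⟩ * X 0 = substHom c (ψ x) := by
  have h := blowupAlgebra.lift_div_mul (maximalIdeal R) (stepHom_t_mem_nonZeroDivisors t ψ c hψt)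
    (by rw [stepHom_t t ψ c hψt]; exact map_maximalIdeal_stepHom_le ψ c) hx
  calc stepLift t ψ c hψt ⟨_, div_mem_blowupAlgebra (maximalIdeal R) t hx⟩ * X 0
      = stepLift t ψ c hψt ⟨_, div_mem_blowupAlgebra (maximalIdeal R) t hx⟩ * stepHom ψ c t := by
        rw [stepHom_t t ψ c hψt]
    _ = stepHom ψ c x := h
    _ = substHom c (ψ x) := rfl

/-- **THE NEW FRAME COORDINATE, first form**: if `ψ r ≡ y_i + λ t (mod 𝔪²)` then `ψ′₀(r/t) ≡ y_i + (c_i + λ) (mod t)`. [folklore] -/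
theorem stepLift_div_sub_mem_span {r : R} (hr : r ∈ maximalIdeal R) {i : Fin 4} (hi : i ≠ 0) {lam : κ}
    (hψr : ψ r - X i - C lam * X 0 ∈ maximalIdeal (MvPowerSeries (Fin 4) κ) ^ 2) :
    stepLift t ψ c hψt ⟨_, div_mem_blowupAlgebra (maximalIdeal R) t hr⟩ - X i - C (c i + lam) ∈
      Ideal.span {(X 0 : MvPowerSeries (Fin 4) κ)} := by
  apply mem_span_X_zero_of_mul_mem_sq
  have hq := substHom_mem_span_X_zero_sq c hψr
  rw [map_sub, map_sub, map_mul, substHom_C, substHom_X_of_ne c hi, substHom_X_zero, ← stepLift_div_mul c hψt hr] at hq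
  convert hq using 1
  simp only [map_add]
  ring

/-- **THE NEW FRAME COORDINATE**: with `c̃ ∈ R` lifting `c_i + λ`, `r′ = r/t − c̃` satisfies `ψ′₀(r′) ≡ y_i (mod t)`. [folklore] -/
theorem stepLift_newCoord_sub_mem_span {r : R} (hr : r ∈ maximalIdeal R) {i : Fin 4} (hi : i ≠ 0) {lam : κ}
    (hψr : ψ r - X i - C lam * X 0 ∈ maximalIdeal (MvPowerSeries (Fin 4) κ) ^ 2) {ct : R}
    (hct : ψ ct - C (c i + lam) ∈ maximalIdeal (MvPowerSeries (Fin 4) κ)) :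
    stepLift t ψ c hψt (⟨_, div_mem_blowupAlgebra (maximalIdeal R) t hr⟩ - algebraMap R _ ct) - X i ∈
      Ideal.span {(X 0 : MvPowerSeries (Fin 4) κ)} := by
  have h1 := stepLift_div_sub_mem_span c hψt hr hi hψr
  have h2 := substHom_sub_C_mem_span c hct
  rw [map_sub, stepLift_algebraMap]
  have : stepLift t ψ c hψt ⟨_, div_mem_blowupAlgebra (maximalIdeal R) t hr⟩ - substHom c (ψ ct) - X i =
      (stepLift t ψ c hψt ⟨_, div_mem_blowupAlgebra (maximalIdeal R) t hr⟩ - X i - C (c i + lam)) -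
        (substHom c (ψ ct) - C (c i + lam)) := by ring
  rw [this]
  exact Ideal.sub_mem _ h1 h2

/-! ### §3. Localising at the point seen by the frame -/

/-- **The point of the chart seen by the frame**: `𝔔_c = ψ′₀⁻¹(𝔪)`, a prime of `R[𝔪/t]` containing `t`. [folklore] -/
abbrev stepPrime : Ideal (blowupAlgebra (maximalIdeal R) t) :=
  Ideal.comap (stepLift t ψ c hψt) (maximalIdeal (MvPowerSeries (Fin 4) κ))

/-- `t ∈ 𝔔_c`. [folklore] -/
theorem algebraMap_t_mem_stepPrime : algebraMap R _ t ∈ stepPrime c hψt := by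
  rw [stepPrime, Ideal.mem_comap, stepLift_t, mem_maximalIdeal_iff, constantCoeff_X]

/-- Off `𝔔_c` the lift takes unit values. [folklore] -/
theorem isUnit_stepLift_of_not_mem {b : blowupAlgebra (maximalIdeal R) t} (hb : b ∉ stepPrime c hψt) :
    IsUnit (stepLift t ψ c hψt b) := by
  by_contra hu
  exact hb ((IsLocalRing.mem_maximalIdeal _).mpr hu)

variable (R' : Type u) [CommRing R'] [Algebra (blowupAlgebra (maximalIdeal R) t) R']
  [IsLocalization.AtPrime R' (stepPrime c hψt)]

/-- **THE NEW FRAME `ψ′ : R[𝔪/t]_{𝔔_c} → κ⟦t, y⟧`** (localisation of the lift). [folklore] -/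
def stepFrame : R' →+* MvPowerSeries (Fin 4) κ :=
  IsLocalization.lift (M := (stepPrime c hψt).primeCompl) (g := stepLift t ψ c hψt)
    fun y => isUnit_stepLift_of_not_mem c hψt y.2

/-- `ψ′` extends `ψ′₀`. [folklore] -/
theorem stepFrame_algebraMap (b : blowupAlgebra (maximalIdeal R) t) :
    stepFrame c hψt R' (algebraMap _ R' b) = stepLift t ψ c hψt b :=
  IsLocalization.lift_eq _ _

/-- **THE COMMUTATION**: `ψ′ ∘ (R → R′) = (y ↦ t y + c t) ∘ ψ`. [folklore] -/
theorem stepFrame_algebraMap_algebraMap [Algebra R R'] [IsScalarTower R (blowupAlgebra (maximalIdeal R) t) R'] (r : R) :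
    stepFrame c hψt R' (algebraMap R R' r) = subst (Series.transChartSubst c) (ψ r) := by
  rw [IsScalarTower.algebraMap_apply R (blowupAlgebra (maximalIdeal R) t) R', stepFrame_algebraMap,
    stepLift_algebraMap, substHom_apply]

/-- `ψ′(t) = t`. [folklore] -/
theorem stepFrame_t [Algebra R R'] [IsScalarTower R (blowupAlgebra (maximalIdeal R) t) R'] :
    stepFrame c hψt R' (algebraMap R R' t) = X 0 := by
  rw [stepFrame_algebraMap_algebraMap, hψt, subst_X (Series.hasSubst_transChartSubst c), Series.transChartSubst_apply_zero]

/-- **`ψ′` is a LOCAL homomorphism** (so the construction iterates). [folklore] -/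
theorem isLocalHom_stepFrame : IsLocalHom (stepFrame c hψt R') := by
  constructor
  intro z hz
  obtain ⟨⟨b, s⟩, rfl⟩ := IsLocalization.mk'_surjective (stepPrime c hψt).primeCompl z
  rw [IsLocalization.AtPrime.isUnit_mk'_iff]
  intro hb
  have hspec := (IsLocalization.lift_mk'_spec (M := (stepPrime c hψt).primeCompl)
    (g := stepLift t ψ c hψt) (fun y => isUnit_stepLift_of_not_mem c hψt y.2) b
    (stepFrame c hψt R' (IsLocalization.mk' R' b s)) s).mp rfl
  have hu : IsUnit (stepLift t ψ c hψt b) := by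
    rw [hspec]; exact (isUnit_stepLift_of_not_mem c hψt s.2).mul hz
  exact ((IsLocalRing.mem_maximalIdeal _).mp (Ideal.mem_comap.mp hb)) hu

/-- **The strict-transform equation read in `R′`**. [folklore] -/
theorem subst_transChartSubst_eq_of_strictTransform' [Algebra R R'] [IsScalarTower R (blowupAlgebra (maximalIdeal R) t) R']
    {h : R} {m : ℕ} {h' : blowupAlgebra (maximalIdeal R) t} (hh' : algebraMap R _ h = algebraMap R _ t ^ m * h') :
    subst (Series.transChartSubst c) (ψ h) = X 0 ^ m * stepFrame c hψt R' (algebraMap _ R' h') := by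
  rw [stepFrame_algebraMap, subst_transChartSubst_eq_of_strictTransform c hψt hh']

end Step

end FormalFrame

end Summit.ResolutionOfSingularities.ResolutionOfSingularities.Cruxes.SigmaMaxModifications.IdeasL1C5

end
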